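import Summits.HubbardSuperconductivity.HubbardSuperconductivity.Theorems.TwTipContinuation.Negative.AbstractTipShapeFalse

/-!
# Crux `PbContinuation` (stmt-HubbardSuperconductivity-0907; = `LevyLogBootstrap.Continuation`,
# `AnisotropyChord.Continuation`, `PolyaSchurPairBoson.Continuation`) — the UNIFORM-WALK shape does
# not give EVERY-ground-state order at the endpoint `t' = 1` (negative-side support, cdisprove cycle 1)

The crux continues every-ground-state `d_{x²-y²}` order of the checkerboard tori
`H_L(t') = H_intra + t'·T_inter` (affine in `t'`, `PbContinuationEndpointClosure.twoHopping_eq_add_smul`)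
from small `t'` to the uniform point `t' = 1`, where the conclusion is again an EVERY-ground-state
bound (`TwTipContinuation.Negative.summitMatrix_iff_everyGSOrder`). The landed positive bookkeeping
(`Theorems/PbContinuationEndpointClosure.lean`, `exists_groundState_order_at_one`) turns an every-GS
bound on a left neighbourhood `[t₁, 1)` into an order bound for SOME ground state at `t' = 1`, and
`Theorems/PbContinuationEndpointUniqueness.lean` upgrades it to EVERY ground state under the extra
hypothesis that the pure-torus sector ground state is unique (`UniqueAtOne` of the strategist census,
decomposition D4). This file records, sorry-free, that the uniqueness hypothesis is LOAD-BEARING for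
abstract affine families: with `A = diag(0, -1)`, `V = diag(0, 1)`, `P = diag(0, 1) ≥ 0` the family
`A + tV = diag(0, t - 1)` has the unique unit ground states `±e₁`, all with `⟨P⟩ = 1`, for EVERY
`t < 1` (in particular on all of `[0, 1)`, with one `t`-uniform constant — the strongest walk
hypothesis, stronger than the crux's anchor on `(0, t₀)` and than the census's `UniformWalkIco`),
while at `t = 1` the Hamiltonian is `0`, the dark vector `e₀` (`⟨P⟩ = 0`) is a ground state, and the
every-GS conclusion fails: an exact level crossing AT the endpoint. So "every-GS order along the
whole walk ⟹ every-GS order at `t' = 1`" is not a principle of linear algebra; what survives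
abstractly is only the `∃`-GS conclusion (`exists_groundState_order_at_one`). In the many-body problem
this is the scenario "an exactly degenerate dark ground state of the pure torus `hubbardTorus 2 L 1 U`
in the sector `(2⌊(1-δ)L²/2⌋, 0)` at the chosen `(U, δ, L)`"; it complements the crux-workfile
refutation `Cruxes/PbContinuation/IdeationR1K2.not_abstractContinuationShape` (crossing strictly
between `t₀` and `1`, where even the `∃`-GS conclusion fails) and is the `t'`-walk twin of
`TwTipContinuation.Negative.not_abstractUniformRungsShape` (seed walk `g ↓ 0`).

* `not_abstractUniformWalkShape` — `¬ ∀ (A V P : Matrix (Fin 2) (Fin 2) ℝ), P.PosSemidef →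
  (∀ t < 1, every unit minimiser `v` of `⟨v,(A + tV)v⟩` has `1 ≤ ⟨v,Pv⟩`) →
  (every unit minimiser of `⟨v,(A + V)v⟩` has `0 < ⟨v,Pv⟩`)`.

Elementary linear algebra (level crossing of a `2 × 2` diagonal family at the endpoint); folklore.
(`toy_norm`, `toy_formA` are reused from `TwTipContinuation.Negative.AbstractTipShapeFalse`.)
-/

namespace Summit.HubbardSuperconductivity.PbContinuation.Negative

open Matrix
open Summit.HubbardSuperconductivity.TwTipContinuation.Negative (toy_norm toy_formA)

/-- `⟨v, (A + tV) v⟩ = (t − 1) v₁²` for `A = diag(0,−1)`, `V = diag(0,1)`. [folklore] -/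
theorem walkToy_form (t : ℝ) (v : Fin 2 → ℝ) :
    v ⬝ᵥ (Matrix.diagonal ![(0 : ℝ), -1] + t • Matrix.diagonal ![(0 : ℝ), 1]) *ᵥ v =
      (t - 1) * v 1 ^ 2 := by
  simp [Matrix.mulVec, dotProduct, Fin.sum_univ_two, Matrix.diagonal, Matrix.add_apply]
  ring

/-- At the endpoint the toy Hamiltonian vanishes: `⟨v, (A + V) v⟩ = 0`. [folklore] -/
theorem walkToy_form_one (v : Fin 2 → ℝ) :
    v ⬝ᵥ (Matrix.diagonal ![(0 : ℝ), -1] + Matrix.diagonal ![(0 : ℝ), 1]) *ᵥ v = 0 := by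
  simp [Matrix.mulVec, dotProduct, Fin.sum_univ_two, Matrix.diagonal, Matrix.add_apply]

/-- **The uniform-walk shape is FALSE for abstract affine families** (exact level crossing AT the
endpoint `t = 1`): with `A = diag(0,−1)`, `V = diag(0,1)`, `P = diag(0,1) ≥ 0`, every unit minimiser
of `⟨v,(A + tV)v⟩` has `⟨v,Pv⟩ = 1` for EVERY `t < 1` (one constant along the whole walk), while the
unit minimiser `e₀` of `⟨v,(A + V)v⟩ = 0` has `⟨v,Pv⟩ = 0`. Hence no hypothesis of every-GS order
along the walk `t' ↑ 1` — however uniform in `t'` — yields the EVERY-ground-state order of the crux's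
conclusion at `t' = 1` by bookkeeping; uniqueness of the endpoint ground state
(`PbContinuation.forall_groundState_order_at_one_of_unique`) or model-specific input is needed, and
only the `∃`-GS conclusion (`PbContinuation.exists_groundState_order_at_one`) is free. [folklore] -/
theorem not_abstractUniformWalkShape :
    ¬ (∀ (A V P : Matrix (Fin 2) (Fin 2) ℝ), P.PosSemidef →
        (∀ t : ℝ, t < 1 → ∀ v : Fin 2 → ℝ, (v ⬝ᵥ v = 1 ∧ ∀ w : Fin 2 → ℝ, w ⬝ᵥ w = 1 →
            v ⬝ᵥ (A + t • V) *ᵥ v ≤ w ⬝ᵥ (A + t • V) *ᵥ w) → 1 ≤ v ⬝ᵥ P *ᵥ v) →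
        ∀ v : Fin 2 → ℝ, (v ⬝ᵥ v = 1 ∧ ∀ w : Fin 2 → ℝ, w ⬝ᵥ w = 1 →
            v ⬝ᵥ (A + V) *ᵥ v ≤ w ⬝ᵥ (A + V) *ᵥ w) → 0 < v ⬝ᵥ P *ᵥ v) := by
  intro h
  have hP : (Matrix.diagonal ![(0 : ℝ), 1]).PosSemidef :=
    Matrix.PosSemidef.diagonal (by intro i; fin_cases i <;> simp)
  -- lit along the whole walk: for `t < 1` every unit minimiser is `±e₁`, `⟨P⟩ = 1`
  have hlit : ∀ t : ℝ, t < 1 → ∀ v : Fin 2 → ℝ, (v ⬝ᵥ v = 1 ∧ ∀ w : Fin 2 → ℝ, w ⬝ᵥ w = 1 →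
      v ⬝ᵥ (Matrix.diagonal ![(0 : ℝ), -1] + t • Matrix.diagonal ![(0 : ℝ), 1]) *ᵥ v ≤
        w ⬝ᵥ (Matrix.diagonal ![(0 : ℝ), -1] + t • Matrix.diagonal ![(0 : ℝ), 1]) *ᵥ w) →
      1 ≤ v ⬝ᵥ Matrix.diagonal ![(0 : ℝ), 1] *ᵥ v := by
    rintro t ht v ⟨hn, hmin⟩
    have h1 := hmin ![0, 1] (by simp [dotProduct, Fin.sum_univ_two])
    rw [walkToy_form, walkToy_form] at h1
    rw [toy_norm] at hn
    rw [toy_formA]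
    simp at h1
    -- h1 : (t - 1) * v 1 ^ 2 ≤ t - 1, with t - 1 < 0, forces v 1 ^ 2 ≥ 1
    nlinarith [sq_nonneg (v 0), sq_nonneg (v 1)]
  -- dark at the endpoint: `e₀` is a ground state of `A + V = 0` with `⟨P⟩ = 0`
  have hgs : (![1, 0] : Fin 2 → ℝ) ⬝ᵥ ![1, 0] = 1 ∧ ∀ w : Fin 2 → ℝ, w ⬝ᵥ w = 1 →
      ![1, 0] ⬝ᵥ (Matrix.diagonal ![(0 : ℝ), -1] + Matrix.diagonal ![(0 : ℝ), 1]) *ᵥ ![1, 0] ≤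
        w ⬝ᵥ (Matrix.diagonal ![(0 : ℝ), -1] + Matrix.diagonal ![(0 : ℝ), 1]) *ᵥ w := by
    refine ⟨by simp [dotProduct, Fin.sum_univ_two], fun w _ => ?_⟩
    rw [walkToy_form_one, walkToy_form_one]
  have := h _ _ _ hP hlit ![1, 0] hgs
  rw [toy_formA] at this
  simp at this

end Summit.HubbardSuperconductivity.PbContinuation.Negative
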